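import Mathlib
import Summits.Ventures.PercRepro2.Defs
import Summits.Ventures.PercRepro2.Independence
import Summits.Ventures.PercRepro2.Harris
import Summits.Ventures.PercRepro2.Graph
import Summits.Ventures.PercRepro2.Exploration
import Summits.Ventures.PercRepro2.Events
import Summits.Ventures.PercRepro2.FourFunctions
import Summits.Ventures.PercRepro2.Induced
import Summits.Ventures.PercRepro2.Frontier
import Summits.Ventures.PercRepro2.ObsIndependence
import Summits.Ventures.PercRepro2.BHK
import Summits.Ventures.PercRepro2.BHKEvents
import Summits.Ventures.PercRepro2.YBridge
import Summits.Ventures.PercRepro2.YDelta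
import Summits.Ventures.PercRepro2.ZDelta
import Summits.Ventures.PercRepro2.HCov
import Summits.Ventures.PercRepro2.ZMeanBound
import Summits.Ventures.PercRepro2.ZMeanEvents
import Summits.Ventures.PercRepro2.ZMean

/-!
# The mean-field bound `Xexact ≤ Xhat` (blind cell PercRepro2, mine-1 g7; MINE1-MEANFIELD.md §1)

Partition the configuration space by the cluster `W = C(a₃)` (`prob_eq_sum_clusterEvent`); on each
cluster event the six probabilities of `Xexact` reduce to residual-graph probabilities
(`cl_pd_joint`, `cl_joint`, `cl_single`, …) factored by the domain Markov property
(`prob_clusterEvent_inter_eq_mul`); the cross-cluster BHK inequality (`bhk_cross_del`) on a PD-type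
cluster and Harris (`harris_del`) on a T/T′-type cluster bound each per-cluster term by the
corresponding term of `Xhat`.  Hence `ZDelta_of_ZMean : ZMean → ZDelta`.
-/

namespace Summit.Ventures.PercRepro2

section PerCluster

variable {V : Type*} {E : Type*} [Fintype E] [DecidableEq E] [Fintype V] [DecidableEq V]
  {R : Type*} [Field R] [LinearOrder R] [IsStrictOrderedRing R]

/-- The exact contribution of the cluster `W = C(a₃)` to `X`. -/
noncomputable def eW (p : E → R) (ends : E → Sym2 V) (o a₁ a₂ a₃ b : V) (W : Finset V) : R :=
  (prob p (clusterEvent ends a₃ (↑W : Set V) ∩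
        (PDEvent ends a₁ a₂ a₃ ∩ connEvent ends a₁ o ∩ connEvent ends a₂ b)) -
      (prob p (clusterEvent ends a₃ (↑W : Set V) ∩
          (TEvent ends a₁ a₂ a₃ ∩ connEvent ends a₁ o ∩ connEvent ends a₁ b)) -
        prob p (clusterEvent ends a₃ (↑W : Set V) ∩
          (TEvent ends a₁ a₂ a₃ ∩ connEvent ends a₁ o ∩ connEvent ends a₂ b)))) +
    (prob p (clusterEvent ends a₃ (↑W : Set V) ∩
        (PDEvent ends a₁ a₂ a₃ ∩ connEvent ends a₂ o ∩ connEvent ends a₁ b)) -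
      (prob p (clusterEvent ends a₃ (↑W : Set V) ∩
          (TEvent ends a₂ a₁ a₃ ∩ connEvent ends a₂ o ∩ connEvent ends a₂ b)) -
        prob p (clusterEvent ends a₃ (↑W : Set V) ∩
          (TEvent ends a₂ a₁ a₃ ∩ connEvent ends a₂ o ∩ connEvent ends a₁ b))))

/-- The per-cluster term of `Xhat`. -/
noncomputable def termW (p : E → R) (ends : E → Sym2 V) (o a₁ a₂ b : V) (W : Finset V) : R :=
  if a₁ ∈ W then (if a₂ ∈ W then 0 else termT p ends W o a₂ b)
  else (if a₂ ∈ W then termT p ends W o a₁ b else termPD p ends W o a₁ a₂ b)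

omit [LinearOrder R] [IsStrictOrderedRing R] in
/-- `Xhat` as the sum of the per-cluster terms. -/
lemma Xhat_eq_sum (p : E → R) (ends : E → Sym2 V) (o a₁ a₂ a₃ b : V) :
    Xhat p ends o a₁ a₂ a₃ b =
      ∑ W : Finset V, prob p (clusterEvent ends a₃ (↑W : Set V)) * termW p ends o a₁ a₂ b W := rfl

omit [LinearOrder R] [IsStrictOrderedRing R] in
/-- `Xexact` as the sum of the exact per-cluster contributions. -/
lemma Xexact_eq_sum (p : E → R) (ends : E → Sym2 V) (o a₁ a₂ a₃ b : V) :
    Xexact p ends o a₁ a₂ a₃ b = ∑ W : Finset V, eW p ends o a₁ a₂ a₃ b W := by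
  unfold Xexact deltaL deltaH eW
  simp only [Finset.sum_add_distrib, Finset.sum_sub_distrib]
  rw [prob_eq_sum_clusterEvent p ends a₃ (PDEvent ends a₁ a₂ a₃ ∩ connEvent ends a₁ o ∩ connEvent ends a₂ b),
    prob_eq_sum_clusterEvent p ends a₃ (TEvent ends a₁ a₂ a₃ ∩ connEvent ends a₁ o ∩ connEvent ends a₁ b),
    prob_eq_sum_clusterEvent p ends a₃ (TEvent ends a₁ a₂ a₃ ∩ connEvent ends a₁ o ∩ connEvent ends a₂ b),
    prob_eq_sum_clusterEvent p ends a₃ (PDEvent ends a₁ a₂ a₃ ∩ connEvent ends a₂ o ∩ connEvent ends a₁ b),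
    prob_eq_sum_clusterEvent p ends a₃ (TEvent ends a₂ a₁ a₃ ∩ connEvent ends a₂ o ∩ connEvent ends a₂ b),
    prob_eq_sum_clusterEvent p ends a₃ (TEvent ends a₂ a₁ a₃ ∩ connEvent ends a₂ o ∩ connEvent ends a₁ b)]

omit [LinearOrder R] [IsStrictOrderedRing R] in
/-- Domain Markov for a `restrict`-preimage on the cluster event. -/
lemma prob_cl_inter_preimage (p : E → R) (ends : E → Sym2 V) (a₃ : V) (W : Finset V)
    (B : Set (Config E)) :
    prob p (clusterEvent ends a₃ (↑W : Set V) ∩ {ω | restrict (touches ends ↑W)ᶜ ω ∈ B}) =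
      prob p (clusterEvent ends a₃ (↑W : Set V)) * prob p {ω | restrict (touches ends ↑W)ᶜ ω ∈ B} :=
  prob_clusterEvent_inter_eq_mul p ends a₃ (↑W : Set V)
    (dependsOn_restrict (touches ends ↑W)ᶜ fun ω' => ω' ∈ B) disjoint_compl_right

/-- A set contained in an empty intersection has probability `0`. -/
lemma prob_eq_zero_of_subset_empty (p : E → R) (hp : IsProbVec p) {A B : Set (Config E)}
    (hAB : A ⊆ B) (hB : B = ∅) : prob p A = 0 := by
  apply le_antisymm _ (prob_nonneg hp A)
  calc prob p A ≤ prob p B := prob_mono hp hAB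
    _ = 0 := by rw [hB]; exact prob_empty p

omit [Fintype E] [DecidableEq E] in
/-- `connDelEvent` is symmetric in its two vertices. -/
lemma connDelEvent_comm (ends : E → Sym2 V) (W : Finset V) (u w : V) :
    connDelEvent ends W u w = connDelEvent ends W w u := by
  ext ω; simp only [mem_connDelEvent]; exact ⟨conn_symm, conn_symm⟩

omit [Fintype E] [DecidableEq E] in
/-- `delQ` is symmetric in the two roots. -/
lemma delQ_comm (ends : E → Sym2 V) (W : Finset V) (a₁ a₂ : V) :
    delQ ends W a₂ a₁ = delQ ends W a₁ a₂ := by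
  simp only [delQ, connDelEvent_comm ends W a₂ a₁]

omit [Fintype E] [DecidableEq E] [Fintype V] [DecidableEq V] in
/-- `A₁ + A₂ ≤ (c₁ + c₂) / q` from `A_i · q ≤ c_i`, `0 ≤ A_i ≤ q`. -/
lemma add_le_div_of_mul_le {A₁ A₂ c₁ c₂ q : R} (hA₁ : 0 ≤ A₁) (hA₂ : 0 ≤ A₂) (h₁q : A₁ ≤ q)
    (h₂q : A₂ ≤ q) (h₁ : A₁ * q ≤ c₁) (h₂ : A₂ * q ≤ c₂) : A₁ + A₂ ≤ (c₁ + c₂) / q := by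
  rcases (hA₁.trans h₁q).lt_or_eq with hq | hq
  · rw [le_div_iff₀ hq, add_mul]; exact add_le_add h₁ h₂
  · rw [← hq, div_zero]
    have e1 : A₁ = 0 := le_antisymm (h₁q.trans hq.symm.le) hA₁
    have e2 : A₂ = 0 := le_antisymm (h₂q.trans hq.symm.le) hA₂
    rw [e1, e2, add_zero]

omit [Fintype E] [DecidableEq E] in
/-- The residual joint event as the `restrict`-preimage used by the Markov factorisation. -/
lemma delQ_joint_eq_preimage (ends : E → Sym2 V) (W : Finset V) (a₁ a₂ x u y w : V) :
    delQ ends W a₁ a₂ ∩ connDelEvent ends W x u ∩ connDelEvent ends W y w =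
      {ω | restrict (touches ends ↑W)ᶜ ω ∈
        (connEvent ends a₁ a₂)ᶜ ∩ connEvent ends x u ∩ connEvent ends y w} := by
  rw [delQ_eq_preimage, connDelEvent_eq_preimage, connDelEvent_eq_preimage, preimage_inter_eq,
    preimage_inter_eq]

/-- **PD-type cluster bound**: for `a₁, a₂ ∉ W`, `eW ≤ P(C(a₃) = W) · termPD`. -/
theorem eW_le_PD (p : E → R) (hp : IsProbVec p) (ends : E → Sym2 V) (o a₁ a₂ a₃ b : V)
    (W : Finset V) (h1 : a₁ ∉ W) (h2 : a₂ ∉ W) :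
    eW p ends o a₁ a₂ a₃ b W ≤
      prob p (clusterEvent ends a₃ (↑W : Set V)) * termPD p ends W o a₁ a₂ b := by
  classical
  set cl := clusterEvent ends a₃ (↑W : Set V) with hcl
  have hcl0 : 0 ≤ prob p cl := prob_nonneg hp _
  -- the T- and T′-terms vanish
  have hT : cl ∩ TEvent ends a₁ a₂ a₃ = ∅ := cl_T_empty_of_notMem ends W a₁ a₂ a₃ h2
  have hT' : cl ∩ TEvent ends a₂ a₁ a₃ = ∅ := cl_T_empty_of_notMem ends W a₂ a₁ a₃ h1
  have z : ∀ X Y : Set (Config E),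
      prob p (cl ∩ (TEvent ends a₁ a₂ a₃ ∩ X ∩ Y)) = 0 := fun X Y =>
    prob_eq_zero_of_subset_empty p hp (B := cl ∩ TEvent ends a₁ a₂ a₃)
      (fun ω hω => ⟨hω.1, hω.2.1.1⟩) hT
  have z' : ∀ X Y : Set (Config E),
      prob p (cl ∩ (TEvent ends a₂ a₁ a₃ ∩ X ∩ Y)) = 0 := fun X Y =>
    prob_eq_zero_of_subset_empty p hp (B := cl ∩ TEvent ends a₂ a₁ a₃)
      (fun ω hω => ⟨hω.1, hω.2.1.1⟩) hT'
  unfold eW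
  rw [z, z, z', z']
  simp only [sub_zero, sub_self]
  by_cases ho : o ∈ W
  · -- `o` inside the removed cluster: both sides vanish
    have e1 : prob p (cl ∩ (PDEvent ends a₁ a₂ a₃ ∩ connEvent ends a₁ o ∩ connEvent ends a₂ b)) = 0 :=
      prob_eq_zero_of_subset_empty p hp (B := cl ∩ connEvent ends a₁ o)
        (fun ω hω => ⟨hω.1, hω.2.1.2⟩)
        (cl_inter_conn_eq_empty ends a₃ (↑W : Set V) (by simpa using h1) (by simpa using ho))
    have e2 : prob p (cl ∩ (PDEvent ends a₁ a₂ a₃ ∩ connEvent ends a₂ o ∩ connEvent ends a₁ b)) = 0 :=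
      prob_eq_zero_of_subset_empty p hp (B := cl ∩ connEvent ends a₂ o)
        (fun ω hω => ⟨hω.1, hω.2.1.2⟩)
        (cl_inter_conn_eq_empty ends a₃ (↑W : Set V) (by simpa using h2) (by simpa using ho))
    rw [e1, e2]
    simp [termPD, delShareMass, ho]
  by_cases hb : b ∈ W
  · have e1 : prob p (cl ∩ (PDEvent ends a₁ a₂ a₃ ∩ connEvent ends a₁ o ∩ connEvent ends a₂ b)) = 0 :=
      prob_eq_zero_of_subset_empty p hp (B := cl ∩ connEvent ends a₂ b)
        (fun ω hω => ⟨hω.1, hω.2.2⟩)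
        (cl_inter_conn_eq_empty ends a₃ (↑W : Set V) (by simpa using h2) (by simpa using hb))
    have e2 : prob p (cl ∩ (PDEvent ends a₁ a₂ a₃ ∩ connEvent ends a₂ o ∩ connEvent ends a₁ b)) = 0 :=
      prob_eq_zero_of_subset_empty p hp (B := cl ∩ connEvent ends a₁ b)
        (fun ω hω => ⟨hω.1, hω.2.2⟩)
        (cl_inter_conn_eq_empty ends a₃ (↑W : Set V) (by simpa using h1) (by simpa using hb))
    rw [e1, e2]
    simp [termPD, delShareMass, hb]
  -- the generic case: residual factorisation + BHK
  rw [cl_pd_joint ends W a₁ a₂ a₃ a₁ o a₂ b h1 h2 h1 h2,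
    cl_pd_joint ends W a₁ a₂ a₃ a₂ o a₁ b h1 h2 h2 h1, prob_cl_inter_preimage,
    prob_cl_inter_preimage, ← delQ_joint_eq_preimage, ← delQ_joint_eq_preimage, ← mul_add]
  refine mul_le_mul_of_nonneg_left ?_ hcl0
  unfold termPD delShareMass
  simp only [ho, hb, if_false]
  have hq : 0 ≤ prob p (delQ ends W a₁ a₂) := prob_nonneg hp _
  have hb1 := bhk_cross_del p hp ends W a₁ a₂ o b
  have hb2 := bhk_cross_del p hp ends W a₂ a₁ o b
  rw [delQ_comm] at hb2
  refine add_le_div_of_mul_le (prob_nonneg hp _) (prob_nonneg hp _)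
    (prob_mono hp (Set.inter_subset_left.trans Set.inter_subset_left))
    (prob_mono hp (Set.inter_subset_left.trans Set.inter_subset_left)) hb1 hb2

omit [Fintype E] [DecidableEq E] in
/-- If `cl ∩ T = cl` then `cl ∩ (T ∩ X ∩ Y) = cl ∩ (X ∩ Y)`. -/
lemma cl_inter_T_inter {cl T : Set (Config E)} (h : cl ∩ T = cl) (X Y : Set (Config E)) :
    cl ∩ (T ∩ X ∩ Y) = cl ∩ (X ∩ Y) := by
  ext ω
  constructor
  · rintro ⟨hc, ⟨_, hx⟩, hy⟩; exact ⟨hc, hx, hy⟩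
  · rintro ⟨hc, hx, hy⟩
    have ht : ω ∈ cl ∩ T := by rw [h]; exact hc
    exact ⟨hc, ⟨ht.2, hx⟩, hy⟩

/-- The generic T-type estimate: with the free root `x ∉ W` and the absorbed root `y ∈ W`,
`−(P(cl ∩ {x↔o} ∩ {x↔b}) − P(cl ∩ {x↔o} ∩ {y↔b})) ≤ P(cl) · termT W o x b`. -/
lemma T_estimate (p : E → R) (hp : IsProbVec p) (ends : E → Sym2 V) (o a₃ b : V) (W : Finset V)
    (x y : V) (hx : x ∉ W) (hy : y ∈ W) :
    -(prob p (clusterEvent ends a₃ (↑W : Set V) ∩ (connEvent ends x o ∩ connEvent ends x b)) -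
        prob p (clusterEvent ends a₃ (↑W : Set V) ∩ (connEvent ends x o ∩ connEvent ends y b))) ≤
      prob p (clusterEvent ends a₃ (↑W : Set V)) * termT p ends W o x b := by
  classical
  set cl := clusterEvent ends a₃ (↑W : Set V) with hcl
  have hcl0 : 0 ≤ prob p cl := prob_nonneg hp _
  by_cases ho : o ∈ W
  · have e1 : prob p (cl ∩ (connEvent ends x o ∩ connEvent ends x b)) = 0 :=
      prob_eq_zero_of_subset_empty p hp (B := cl ∩ connEvent ends x o)
        (fun ω hω => ⟨hω.1, hω.2.1⟩)
        (cl_inter_conn_eq_empty ends a₃ (↑W : Set V) (by simpa using hx) (by simpa using ho))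
    have e2 : prob p (cl ∩ (connEvent ends x o ∩ connEvent ends y b)) = 0 :=
      prob_eq_zero_of_subset_empty p hp (B := cl ∩ connEvent ends x o)
        (fun ω hω => ⟨hω.1, hω.2.1⟩)
        (cl_inter_conn_eq_empty ends a₃ (↑W : Set V) (by simpa using hx) (by simpa using ho))
    rw [e1, e2]
    simp [termT, delConnProb, ho]
  -- the joint light term
  have hj : prob p (cl ∩ (connEvent ends x o ∩ connEvent ends x b)) =
      prob p cl * prob p (connDelEvent ends W x o ∩ connDelEvent ends W x b) := by
    rw [cl_joint ends W a₃ x o x b hx hx, prob_cl_inter_preimage, connDelEvent_eq_preimage,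
      connDelEvent_eq_preimage, preimage_inter_eq]
  have hs : prob p (cl ∩ connEvent ends x o) = prob p cl * prob p (connDelEvent ends W x o) := by
    rw [cl_single ends W a₃ x o hx, prob_cl_inter_preimage, connDelEvent_eq_preimage]
  have hh := harris_del p hp ends W x o b
  unfold termT delConnProb
  simp only [ho, if_false]
  by_cases hb : b ∈ W
  · have e2 : cl ∩ (connEvent ends x o ∩ connEvent ends y b) = cl ∩ connEvent ends x o := by
      ext ω
      constructor
      · rintro ⟨hc, hxo, _⟩; exact ⟨hc, hxo⟩
      · rintro ⟨hc, hxo⟩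
        have : ω ∈ cl ∩ connEvent ends y b := by
          rw [cl_inter_conn_of_mem_mem ends a₃ (↑W : Set V) (by simpa using hy) (by simpa using hb)]
          exact hc
        exact ⟨hc, hxo, this.2⟩
    rw [e2, hs, hj, if_pos hb, mul_one]
    have : 0 ≤ prob p cl * prob p (connDelEvent ends W x o ∩ connDelEvent ends W x b) :=
      mul_nonneg hcl0 (prob_nonneg hp _)
    linarith
  · have e2 : prob p (cl ∩ (connEvent ends x o ∩ connEvent ends y b)) = 0 :=
      prob_eq_zero_of_subset_empty p hp (B := cl ∩ connEvent ends y b)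
        (fun ω hω => ⟨hω.1, hω.2.2⟩)
        (cl_inter_conn_eq_empty' ends a₃ (↑W : Set V) (by simpa using hy) (by simpa using hb))
    simp only [hb, if_false]
    rw [e2, hj, sub_zero]
    have := mul_le_mul_of_nonneg_left hh hcl0
    linarith

/-- **T-type cluster bound**: for `a₁ ∉ W`, `a₂ ∈ W`, `eW ≤ P(C(a₃) = W) · termT W o a₁ b`. -/
theorem eW_le_T (p : E → R) (hp : IsProbVec p) (ends : E → Sym2 V) (o a₁ a₂ a₃ b : V)
    (W : Finset V) (h1 : a₁ ∉ W) (h2 : a₂ ∈ W) :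
    eW p ends o a₁ a₂ a₃ b W ≤
      prob p (clusterEvent ends a₃ (↑W : Set V)) * termT p ends W o a₁ b := by
  classical
  set cl := clusterEvent ends a₃ (↑W : Set V) with hcl
  have hPD : cl ∩ PDEvent ends a₁ a₂ a₃ = ∅ := cl_PD_empty_of_mem₂ ends W a₁ a₂ a₃ h2
  have hT' : cl ∩ TEvent ends a₂ a₁ a₃ = ∅ := cl_T_empty_of_notMem ends W a₂ a₁ a₃ h1
  have hT : cl ∩ TEvent ends a₁ a₂ a₃ = cl := cl_subset_T ends W a₁ a₂ a₃ h1 h2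
  have zPD : ∀ X Y : Set (Config E), prob p (cl ∩ (PDEvent ends a₁ a₂ a₃ ∩ X ∩ Y)) = 0 :=
    fun X Y => prob_eq_zero_of_subset_empty p hp (B := cl ∩ PDEvent ends a₁ a₂ a₃)
      (fun ω hω => ⟨hω.1, hω.2.1.1⟩) hPD
  have zT' : ∀ X Y : Set (Config E), prob p (cl ∩ (TEvent ends a₂ a₁ a₃ ∩ X ∩ Y)) = 0 :=
    fun X Y => prob_eq_zero_of_subset_empty p hp (B := cl ∩ TEvent ends a₂ a₁ a₃)
      (fun ω hω => ⟨hω.1, hω.2.1.1⟩) hT'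
  unfold eW
  rw [zPD, zPD, zT', zT', cl_inter_T_inter hT, cl_inter_T_inter hT]
  simp only [sub_self, add_zero, zero_sub]
  exact T_estimate p hp ends o a₃ b W a₁ a₂ h1 h2

/-- **T′-type cluster bound**: for `a₁ ∈ W`, `a₂ ∉ W`, `eW ≤ P(C(a₃) = W) · termT W o a₂ b`. -/
theorem eW_le_T' (p : E → R) (hp : IsProbVec p) (ends : E → Sym2 V) (o a₁ a₂ a₃ b : V)
    (W : Finset V) (h1 : a₁ ∈ W) (h2 : a₂ ∉ W) :
    eW p ends o a₁ a₂ a₃ b W ≤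
      prob p (clusterEvent ends a₃ (↑W : Set V)) * termT p ends W o a₂ b := by
  classical
  set cl := clusterEvent ends a₃ (↑W : Set V) with hcl
  have hPD : cl ∩ PDEvent ends a₁ a₂ a₃ = ∅ := cl_PD_empty_of_mem₁ ends W a₁ a₂ a₃ h1
  have hT : cl ∩ TEvent ends a₁ a₂ a₃ = ∅ := cl_T_empty_of_notMem ends W a₁ a₂ a₃ h2
  have hT' : cl ∩ TEvent ends a₂ a₁ a₃ = cl := cl_subset_T ends W a₂ a₁ a₃ h2 h1
  have zPD : ∀ X Y : Set (Config E), prob p (cl ∩ (PDEvent ends a₁ a₂ a₃ ∩ X ∩ Y)) = 0 :=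
    fun X Y => prob_eq_zero_of_subset_empty p hp (B := cl ∩ PDEvent ends a₁ a₂ a₃)
      (fun ω hω => ⟨hω.1, hω.2.1.1⟩) hPD
  have zT : ∀ X Y : Set (Config E), prob p (cl ∩ (TEvent ends a₁ a₂ a₃ ∩ X ∩ Y)) = 0 :=
    fun X Y => prob_eq_zero_of_subset_empty p hp (B := cl ∩ TEvent ends a₁ a₂ a₃)
      (fun ω hω => ⟨hω.1, hω.2.1.1⟩) hT
  unfold eW
  rw [zPD, zPD, zT, zT, cl_inter_T_inter hT', cl_inter_T_inter hT']
  simp only [sub_self, zero_add, zero_sub]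
  exact T_estimate p hp ends o a₃ b W a₂ a₁ h2 h1

omit [Fintype V] [DecidableEq V] in
/-- **Both roots in the cluster**: `eW = 0`. -/
theorem eW_eq_zero_of_mem_both (p : E → R) (hp : IsProbVec p) (ends : E → Sym2 V)
    (o a₁ a₂ a₃ b : V) (W : Finset V) (h1 : a₁ ∈ W) (h2 : a₂ ∈ W) :
    eW p ends o a₁ a₂ a₃ b W = 0 := by
  classical
  set cl := clusterEvent ends a₃ (↑W : Set V) with hcl
  have hPD : cl ∩ PDEvent ends a₁ a₂ a₃ = ∅ := cl_PD_empty_of_mem₁ ends W a₁ a₂ a₃ h1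
  have hT : cl ∩ TEvent ends a₁ a₂ a₃ = ∅ :=
    cl_T_empty_of_mem_both ends (↑W : Set V) a₁ a₂ a₃ (by simpa using h1) (by simpa using h2)
  have hT' : cl ∩ TEvent ends a₂ a₁ a₃ = ∅ :=
    cl_T_empty_of_mem_both ends (↑W : Set V) a₂ a₁ a₃ (by simpa using h2) (by simpa using h1)
  have zPD : ∀ X Y : Set (Config E), prob p (cl ∩ (PDEvent ends a₁ a₂ a₃ ∩ X ∩ Y)) = 0 :=
    fun X Y => prob_eq_zero_of_subset_empty p hp (B := cl ∩ PDEvent ends a₁ a₂ a₃)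
      (fun ω hω => ⟨hω.1, hω.2.1.1⟩) hPD
  have zT : ∀ X Y : Set (Config E), prob p (cl ∩ (TEvent ends a₁ a₂ a₃ ∩ X ∩ Y)) = 0 :=
    fun X Y => prob_eq_zero_of_subset_empty p hp (B := cl ∩ TEvent ends a₁ a₂ a₃)
      (fun ω hω => ⟨hω.1, hω.2.1.1⟩) hT
  have zT' : ∀ X Y : Set (Config E), prob p (cl ∩ (TEvent ends a₂ a₁ a₃ ∩ X ∩ Y)) = 0 :=
    fun X Y => prob_eq_zero_of_subset_empty p hp (B := cl ∩ TEvent ends a₂ a₁ a₃)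
      (fun ω hω => ⟨hω.1, hω.2.1.1⟩) hT'
  unfold eW
  rw [zPD, zPD, zT, zT, zT', zT']
  ring

/-- **Per-cluster bound**: `eW ≤ P(C(a₃) = W) · termW` for every `W`. -/
theorem eW_le_termW (p : E → R) (hp : IsProbVec p) (ends : E → Sym2 V) (o a₁ a₂ a₃ b : V)
    (W : Finset V) :
    eW p ends o a₁ a₂ a₃ b W ≤
      prob p (clusterEvent ends a₃ (↑W : Set V)) * termW p ends o a₁ a₂ b W := by
  unfold termW
  by_cases h1 : a₁ ∈ W <;> by_cases h2 : a₂ ∈ W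
  · rw [if_pos h1, if_pos h2, mul_zero]; exact (eW_eq_zero_of_mem_both p hp ends o a₁ a₂ a₃ b W h1 h2).le
  · rw [if_pos h1, if_neg h2]; exact eW_le_T' p hp ends o a₁ a₂ a₃ b W h1 h2
  · rw [if_neg h1, if_pos h2]; exact eW_le_T p hp ends o a₁ a₂ a₃ b W h1 h2
  · rw [if_neg h1, if_neg h2]; exact eW_le_PD p hp ends o a₁ a₂ a₃ b W h1 h2

/-- **THE MEAN-FIELD BOUND**: `Xexact ≤ Xhat` (MINE1-MEANFIELD.md §1). -/
theorem Xexact_le_Xhat (p : E → R) (hp : IsProbVec p) (ends : E → Sym2 V) (o a₁ a₂ a₃ b : V) :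
    Xexact p ends o a₁ a₂ a₃ b ≤ Xhat p ends o a₁ a₂ a₃ b := by
  rw [Xexact_eq_sum, Xhat_eq_sum]
  exact Finset.sum_le_sum fun W _ => eW_le_termW p hp ends o a₁ a₂ a₃ b W

/-- **`ZMean → ZDelta`**: the crux follows from its a₃-exploration mean-field form (row 2′MF). -/
theorem ZDelta_of_ZMean (p : E → R) (hp : IsProbVec p) (ends : E → Sym2 V) (o a₁ a₂ a₃ b : V)
    (h : ZMean p ends o a₁ a₂ a₃ b) : ZDelta p ends o a₁ a₂ a₃ b :=
  ZDelta_of_ZMean_of_le p hp ends o a₁ a₂ a₃ b (Xexact_le_Xhat p hp ends o a₁ a₂ a₃ b) h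

end PerCluster

end Summit.Ventures.PercRepro2

namespace Summit.Ventures.PercRepro2

/-! ## The mean-field form of (HCOV): `HMF → HCov` (CONJECTURES row 2′HMF) -/

section HMF

variable {V : Type*} {E : Type*} [Fintype E] [DecidableEq E] [Fintype V] [DecidableEq V]
  {R : Type*} [Field R] [LinearOrder R] [IsStrictOrderedRing R]

/-- **`HMFc = D · P(Q) · G-mean`**: the cleared mean-field value of the (HCOV) functional,
`2 P(Q) · (D_o W − D X̂) − gap · marginC` (`CovForm.two_Z_eq` with `X` replaced by `X̂`). -/
noncomputable def HMFc (p : E → R) (ends : E → Sym2 V) (o a₁ a₂ a₃ b : V) : R :=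
  2 * prob p (avoidAll ends a₂ {a₁}) *
      ((prob p (PDEvent ends a₁ a₂ a₃ ∩ connEvent ends a₁ o) +
            prob p (PDEvent ends a₁ a₂ a₃ ∩ connEvent ends a₂ o)) *
          (massM2 p ends a₁ a₂ a₃ b + deltaT p ends a₁ a₂ a₃ b) -
        Xhat p ends o a₁ a₂ a₃ b * prob p (PDEvent ends a₁ a₂ a₃)) -
    CovForm.gap p ends a₁ a₂ b * CovForm.marginC p ends o a₁ a₂ a₃

/-- **(HMF)** (row 2′HMF): `0 ≤ HMFc` — the labelling-free mean-field form of (HCOV). -/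
def HMF (p : E → R) (ends : E → Sym2 V) (o a₁ a₂ a₃ b : V) : Prop :=
  0 ≤ HMFc p ends o a₁ a₂ a₃ b

/-- **`HMFc ≤ Gc`**: the mean-field bound `Xexact ≤ Xhat` inside `two_Z_eq`. -/
theorem HMFc_le_Gc (p : E → R) (hp : IsProbVec p) (ends : E → Sym2 V) (o a₁ a₂ a₃ b : V) :
    HMFc p ends o a₁ a₂ a₃ b ≤ CovForm.Gc p ends o a₁ a₂ a₃ b := by
  have hid := CovForm.two_Z_eq p ends o a₁ a₂ a₃ b
  have hX := Xexact_le_Xhat p hp ends o a₁ a₂ a₃ b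
  have hQ : 0 ≤ prob p (avoidAll ends a₂ {a₁}) := prob_nonneg hp _
  have hD : 0 ≤ prob p (PDEvent ends a₁ a₂ a₃) := prob_nonneg hp _
  unfold HMFc
  unfold Xexact at hX
  have h1 : 0 ≤ 2 * prob p (avoidAll ends a₂ {a₁}) * prob p (PDEvent ends a₁ a₂ a₃) := by
    have := mul_nonneg hQ hD; linarith
  nlinarith [mul_le_mul_of_nonneg_left hX h1]

/-- **(HCOV) ⟸ (HMF)**: the chain of record continues through the mean-field form. -/
theorem HCov_of_HMF (p : E → R) (hp : IsProbVec p) (ends : E → Sym2 V) (o a₁ a₂ a₃ b : V)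
    (h : HMF p ends o a₁ a₂ a₃ b) : CovForm.HCov p ends o a₁ a₂ a₃ b := by
  unfold CovForm.HCov
  exact le_trans h (HMFc_le_Gc p hp ends o a₁ a₂ a₃ b)

/-- **(ZΔ) ⟸ (HMF)** on every labelled instance (via `CovForm.ZDelta_of_HCov`). -/
theorem ZDelta_of_HMF (p : E → R) (hp : IsProbVec p) (ends : E → Sym2 V) {o a₁ a₂ a₃ b : V}
    (hord : prob p (connEvent ends a₁ b) ≤ prob p (connEvent ends a₂ b))
    (h : HMF p ends o a₁ a₂ a₃ b) : ZDelta p ends o a₁ a₂ a₃ b :=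
  CovForm.ZDelta_of_HCov p hp ends hord (HCov_of_HMF p hp ends o a₁ a₂ a₃ b h)

end HMF

end Summit.Ventures.PercRepro2
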